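import Summits.ABC.ABC.Theses.IneffectiveSubspace

/-!
# `AbcGivesTower`: ABC ⟹ the level-`n` tower inequality with exponent `1` (item stmt-ABC-1652)

Upper half of the sandwich of route `IneffectiveSubspace` (Vojta 2000, §3, Lemmas 3.5–3.6 and the
proof of Thm 3.12): for a positive point of Vojta's hypersurface `X_n`, i.e. positive integers
`x_i, y_i, z_i` with `∏ x_i^(i+1) + ∏ y_i^(i+1) = ∏ z_i^(i+1)` and `gcd(∏ x_i^(i+1), ∏ y_i^(i+1)) = 1`,
put `a = ∏ x_i^(i+1)`, `b = ∏ y_i^(i+1)`, `c = ∏ z_i^(i+1)`. Then `(a, b, c)` is an abc triple and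
`rad(abc) = radical(∏ (x_i y_i z_i)^(i+1)) ∣ ∏ x_i y_i z_i`, so the abc conjecture
`c < C · rad(abc)^(1+ε)` gives `c < C · (∏ x_i y_i z_i)^(1+ε)` with the same constant `C = C(ε)`
(independent of `n`).

Sources: Vojta, *On the ABC conjecture and Diophantine approximation by rational points*,
Amer. J. Math. 122 (2000), §3; Yasufuku 2018 (blow-ups, Thm 3) for the surface analogue.
No new definitions; nothing conditional beyond the hypothesis `ABC` built into the statement.
-/

-- `Summit.<Summit>.<Problem>` is the mandated summit-side namespace (CONVENTIONS §2); for the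
-- single-conjunct summit `ABC` the two coincide, so the duplicate `ABC.ABC` is deliberate.
set_option linter.dupNamespace false

namespace Summit.ABC.ABC.Theorems

open scoped BigOperators
open UniqueFactorizationMonoid Literature.NumberTheory.DiophantineGeometry

/-- The abc product of a tower point is `∏ (x_i y_i z_i)^(i+1)`:
`(∏ x_i^(i+1)) (∏ y_i^(i+1)) (∏ z_i^(i+1)) = ∏ (x_i y_i z_i)^(i+1)`. [folklore] -/
theorem AbcGivesTower.prod_pow_mul_three {n : ℕ} (x y z : Fin n → ℕ) :
    (∏ i, x i ^ (i.val + 1)) * (∏ i, y i ^ (i.val + 1)) * (∏ i, z i ^ (i.val + 1)) =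
      ∏ i, (x i * y i * z i) ^ (i.val + 1) := by
  simp only [mul_pow, Finset.prod_mul_distrib]

/-- The radical of the abc product of a tower point divides the product of its coordinates:
`radical((∏ x_i^(i+1)) (∏ y_i^(i+1)) (∏ z_i^(i+1))) ∣ ∏ x_i y_i z_i` (radical of a product divides
the product of the radicals; `radical(m^(k)) ∣ radical(m) ∣ m`). [cite: Vojta2000ABC, Lemma 3.5] -/
theorem AbcGivesTower.radical_dvd_prod {n : ℕ} (x y z : Fin n → ℕ) :
    radical ((∏ i, x i ^ (i.val + 1)) * (∏ i, y i ^ (i.val + 1)) * (∏ i, z i ^ (i.val + 1))) ∣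
      ∏ i, x i * y i * z i := by
  rw [AbcGivesTower.prod_pow_mul_three]
  refine radical_prod_dvd.trans ?_
  exact Finset.prod_dvd_prod_of_dvd _ _ fun i _ => radical_pow_dvd.trans radical_dvd_self

/-- `rad(a, b, c) ≤ ∏ x_i y_i z_i` for a tower point with positive coordinates, where
`a = ∏ x_i^(i+1)`, `b = ∏ y_i^(i+1)`, `c = ∏ z_i^(i+1)`. [cite: Vojta2000ABC, Lemma 3.5] -/
theorem AbcGivesTower.rad_le_prod {n : ℕ} (x y z : Fin n → ℕ)
    (hpos : ∀ i, 0 < x i ∧ 0 < y i ∧ 0 < z i) :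
    rad (∏ i, x i ^ (i.val + 1)) (∏ i, y i ^ (i.val + 1)) (∏ i, z i ^ (i.val + 1)) ≤
      ∏ i, x i * y i * z i := by
  rw [rad_def]
  have hP : 0 < ∏ i, x i * y i * z i := Finset.prod_pos fun i _ =>
    Nat.mul_pos (Nat.mul_pos (hpos i).1 (hpos i).2.1) (hpos i).2.2
  exact Nat.le_of_dvd hP (AbcGivesTower.radical_dvd_prod x y z)

/-- **ABC ⟹ TowerIneq(n, 1)** (item stmt-ABC-1652, route `IneffectiveSubspace`): under the abc
conjecture, for every level `n ≥ 1` and `ε > 0` there is `C > 0` (namely abc's own `C(ε)`) with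
`∏ z_i^(i+1) < C · (∏ x_i y_i z_i)^(1+ε)` for all positive coprime solutions of
`∏ x_i^(i+1) + ∏ y_i^(i+1) = ∏ z_i^(i+1)`. Proof: `(a,b,c) = (∏ x_i^(i+1), ∏ y_i^(i+1), ∏ z_i^(i+1))`
is an abc triple and `rad(abc) ≤ ∏ x_i y_i z_i`; monotonicity of `t ↦ C t^(1+ε)`.
[cite: Vojta2000ABC, §3 (proof of Thm 3.12)] -/
theorem abcGivesTower_proof : Summit.ABC.ABC.Theses.IneffectiveSubspace.AbcGivesTower := by
  unfold Summit.ABC.ABC.Theses.IneffectiveSubspace.AbcGivesTower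
  intro hABC n _ ε hε
  obtain ⟨C, hC, h⟩ := (ABC_iff.mp hABC) ε hε
  refine ⟨C, hC, ?_⟩
  intro x y z hpos hsum hcop
  have ha : 0 < ∏ i, x i ^ (i.val + 1) := Finset.prod_pos fun i _ => pow_pos (hpos i).1 _
  have hb : 0 < ∏ i, y i ^ (i.val + 1) := Finset.prod_pos fun i _ => pow_pos (hpos i).2.1 _
  have htriple :
      IsABCTriple (∏ i, x i ^ (i.val + 1)) (∏ i, y i ^ (i.val + 1)) (∏ i, z i ^ (i.val + 1)) :=
    ⟨ha, hb, hsum, hcop⟩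
  have hrad :
      ((rad (∏ i, x i ^ (i.val + 1)) (∏ i, y i ^ (i.val + 1)) (∏ i, z i ^ (i.val + 1)) : ℕ) : ℝ) ≤
        ((∏ i, x i * y i * z i : ℕ) : ℝ) := by
    exact_mod_cast AbcGivesTower.rad_le_prod x y z hpos
  calc ((∏ i, z i ^ (i.val + 1) : ℕ) : ℝ)
      < C * ((rad (∏ i, x i ^ (i.val + 1)) (∏ i, y i ^ (i.val + 1))
          (∏ i, z i ^ (i.val + 1)) : ℕ) : ℝ) ^ (1 + ε) := h _ _ _ htriple
    _ ≤ C * ((∏ i, x i * y i * z i : ℕ) : ℝ) ^ (1 + ε) := by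
      gcongr

end Summit.ABC.ABC.Theorems
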